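import Mathlib
import HarnessLib
import Summits.HubbardSuperconductivity.HubbardSuperconductivity.Theorems.FunctionFieldCertificateMesoscopicPairOrderShapeOfPgdAt
import Summits.HubbardSuperconductivity.HubbardSuperconductivity.Theorems.WeakCouplingBCSWcbcsSsbToTorusLROFloatingChargingFloor
import Summits.HubbardSuperconductivity.HubbardSuperconductivity.Theorems.ParentFirstSMABoundCoherentDWavePairsPairGapBinding
import Literature.MathematicalPhysics.QuantumLattice.HubbardRingPerronFrobeniusProofs

/-!
# `MesoscopicPairOrder` (stmt-HubbardSuperconductivity-7331), line `redirect_birth`, stub (GS-box)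
# `stub_pairGoldstoneShapeOnBox`: the TYPED POSITION of its charging input (Ch)

Support file (route `FunctionFieldCertificate`, line `redirect_birth`, lead c11, wave 4; stub worker of (GS-box)).
Wave 3 landed the pointwise glue `goldstoneShapeAt_of_pgdAt_of_chargingFloorAt` ((GD) ∧ (Ch) ⇒ (GS) at one `(U, δ)`,
`…MesoscopicPairOrderShapeOfPgdAt.lean`). Its second input is the CHARGING FLOOR at `(U, δ)`,
(Ch) `∃ κ ≥ 0, ∃ L₀, ∀ even L ≥ L₀, −κ/L ≤ pairGap (hubbardTorus 2 L 1 U) N_L`, `N_L = 2⌊(1−δ)L²/2⌋`,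
`pairGap H N = ½[E(N+2) + E(N−2) − 2E(N)]`, `E(M) = H.minEnergyOn (szSector M 0)` (Lin–Hirsch–Scalapino 1988,
eq. (9)). This file says in Lean WHERE (Ch) sits and WHAT it asks beyond the tree:

* §1 (any `H`, filling `N`, slack `c`; algebra over the definition of `pairGap`): `−c ≤ pairGap H N` iff there is
  a COMMON pair chemical potential `μ` with `E(N) − E(N−2) ≤ 2μ + c` and `2μ − c ≤ E(N+2) − E(N)`
  (`neg_le_pairGap_iff_exists_pairTransferWindow`; `⇒` with `μ = μ̄ = pairChemicalPotential H N`, `⇐` by adding the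
  two lines; any admissible `μ` is `(pairGap + c)/2`-close to `μ̄`, `abs_two_mul_sub_le_of_pairTransferWindow`).
  Each line is ONE variational trial state in the `N`-sector built from the neighbouring sector's ground state.
* §2 (the typed position): at every `(U, δ)`, (Ch) ⟺ the PAIR-TRANSFER WINDOW
  `∃ κ ≥ 0, ∃ L₀, ∀ even L ≥ L₀, ∃ μ, E(N_L) − E(N_L−2) ≤ 2μ + κ/L ∧ 2μ − κ/L ≤ E(N_L+2) − E(N_L)`
  (`chargingFloorAt_iff_pairTransferWindowAt`; registered one-line form `chargingFloorAtIffPairTransferWindowAt`;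
  box form `boxChargingFloor_iff_boxPairTransferWindow`), and the box pair-transfer window feeds the registered
  stub verbatim through wave 3 (`stub_pairGoldstoneShapeOnBox_of_boxPgd_of_boxPairTransferWindow`).
* §3 (what the tree proves, `U ≥ 0`, even `L`): the two ONE-SIDED variational halves with MISMATCHED chemical
  potentials — Yang's `η†`-transfer ceiling `E(2n+2) − E(2n) ≤ U` (`EnslavedA1g.minEnergyOn_szSector_add_two_le`)
  and the removal floor `−8 ≤ E(2n+2) − E(2n)` (`EnslavedA1g.UpperSandwich.minEnergyOn_szSector_le_add_two`) —
  give the sharpest a-priori window `|pairGap (hubbardTorus 2 L 1 U) (2n)| ≤ (U + 8)/2`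
  (`abs_pairGap_le_of_window`; lower half = the `J = 1` case of `WcbcsSsbToTorusLRO.exists_pairGap_ge_of_window`),
  in particular at `N_L` (`abs_pairGap_summitFilling_le`, `summitFilling_steps_mem_window`), `≤ 7` on the box
  (`abs_pairGap_summitFilling_le_seven_onBox`), i.e. the pair-transfer window with slack `(U + 8)/2` in place of
  `κ/L` (`pairTransferWindowAt_apriori`). So (Ch) asks to improve an `O(1)` two-sided window, valid at every
  filling, to `−κ/L` on ONE side at the ONE prescribed filling `N_L`.
* §4 (the edge of the box): at half filling `δ = 0` (outside the box) (Ch) HOLDS with `κ = 0` for every real `U`: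
  particle–hole symmetry `E(L²+2) = E(L²−2) + 2U` and the `η†` ceiling give
  `pairGap H (L²) = U − (E(L²) − E(L²−2)) ≥ 0` (`pairGap_halfFilling_nonneg`, `chargingFloorAt_halfFilling`).

Nothing here proves (Ch), (GD), (GS) or the stub at a box point: an `L`-uniform `O(1/L)` lower bound on the
second difference of `N ↦ E(N)` at a PRESCRIBED doped filling is open for the repulsive Hubbard model in `d ≥ 2`
(no reflection positivity off half filling; one-step bounds valid at every filling cannot localise curvature at one
filling). No definition, no named fact. Sources: Lin–Hirsch–Scalapino, PRB 37 (1988) 7359, eq. (9); C. N. Yang,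
PRL 63 (1989) 2144; E. H. Lieb, PRL 62 (1989) 1201; Lieb–Wu, Physica A 321 (2003) 1, eq. (3); H. Tasaki,
*Physics and Mathematics of Quantum Many-Body Systems* (2020) §2.1.
-/


-- the summit namespace repeats the problem name by design (D-0017)
set_option linter.dupNamespace false

namespace Summit.HubbardSuperconductivity.HubbardSuperconductivity.Theorems.FunctionFieldCertificate

open Matrix Finset
open Literature.Probability.LatticeModels Literature.MathematicalPhysics.QuantumLattice
open Summit.HubbardSuperconductivity.HubbardSuperconductivity.Theses.FunctionFieldCertificate
open scoped ComplexOrder ComplexConjugate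

/-! ### §1 Per-filling algebra: charging floor with slack `c` ⟺ a common pair chemical potential -/

section Algebra

variable {Λ : Type*} [LinearOrder Λ] [Fintype Λ]

/-- **(Ch) with slack `c` ⇒ the pair-transfer window, with the midpoint chemical potential.** If
`−c ≤ pairGap H N` then, with `μ̄ = pairChemicalPotential H N = ¼[E(N+2) − E(N−2)]`,
`E(N) − E(N−2) ≤ 2μ̄ + c` and `2μ̄ − c ≤ E(N+2) − E(N)` (`E(M) = H.minEnergyOn (szSector M 0)`):
both lines equal `pairGap H N ≥ −c` by Lin–Hirsch–Scalapino's `E(N±2) − E(N) ∓ 2μ̄ = Δ`. [folklore] -/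
theorem pairTransferWindow_of_neg_le_pairGap (H : Matrix (Finset (Orb Λ)) (Finset (Orb Λ)) ℂ) (N : ℕ)
    {c : ℝ} (h : -c ≤ pairGap H N) :
    H.minEnergyOn (szSector N 0) - H.minEnergyOn (szSector (N - 2) 0) ≤
        2 * pairChemicalPotential H N + c ∧
      2 * pairChemicalPotential H N - c ≤
        H.minEnergyOn (szSector (N + 2) 0) - H.minEnergyOn (szSector N 0) := by
  have hp := minEnergyOn_add_two_sub_eq_pairGap H N
  have hm := minEnergyOn_sub_two_sub_eq_pairGap H N
  constructor <;> linarith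

/-- **The pair-transfer window ⇒ (Ch) with the same slack.** If some real `μ` satisfies
`E(N) − E(N−2) ≤ 2μ + c` and `2μ − c ≤ E(N+2) − E(N)`, then `−c ≤ pairGap H N`: add the two lines,
`2·pairGap H N = (E(N+2) − E(N)) − (E(N) − E(N−2)) ≥ −2c`. [folklore] -/
theorem neg_le_pairGap_of_pairTransferWindow (H : Matrix (Finset (Orb Λ)) (Finset (Orb Λ)) ℂ) (N : ℕ)
    {c μ : ℝ} (hm : H.minEnergyOn (szSector N 0) - H.minEnergyOn (szSector (N - 2) 0) ≤ 2 * μ + c)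
    (hp : 2 * μ - c ≤ H.minEnergyOn (szSector (N + 2) 0) - H.minEnergyOn (szSector N 0)) :
    -c ≤ pairGap H N := by
  unfold pairGap
  linarith

/-- **Charging floor with slack `c` ⟺ a common pair chemical potential** (any `H`, any `N`, any real `c`):
`−c ≤ pairGap H N ↔ ∃ μ, E(N) − E(N−2) ≤ 2μ + c ∧ 2μ − c ≤ E(N+2) − E(N)`. The two conjuncts are the
variational contents "a pair can be ADDED to the `(N−2)`-ground state at cost `≤ 2μ + c`" and "a pair can
only be added to the `N`-ground state at cost `≥ 2μ − c`", with ONE `μ`. [folklore] -/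
theorem neg_le_pairGap_iff_exists_pairTransferWindow (H : Matrix (Finset (Orb Λ)) (Finset (Orb Λ)) ℂ)
    (N : ℕ) (c : ℝ) :
    -c ≤ pairGap H N ↔ ∃ μ : ℝ,
      H.minEnergyOn (szSector N 0) - H.minEnergyOn (szSector (N - 2) 0) ≤ 2 * μ + c ∧
        2 * μ - c ≤ H.minEnergyOn (szSector (N + 2) 0) - H.minEnergyOn (szSector N 0) :=
  ⟨fun h => ⟨_, pairTransferWindow_of_neg_le_pairGap H N h⟩,
    fun ⟨_, hm, hp⟩ => neg_le_pairGap_of_pairTransferWindow H N hm hp⟩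

/-- **Rigidity of the common chemical potential.** Any `μ` admissible in the pair-transfer window with slack
`c` is pinned to the midpoint one: `|2μ − 2μ̄| ≤ pairGap H N + c` (subtract Lin–Hirsch–Scalapino's two identities
from the two lines): the window's only freedom beyond `μ̄` is of the size of the gap itself. [folklore] -/
theorem abs_two_mul_sub_le_of_pairTransferWindow (H : Matrix (Finset (Orb Λ)) (Finset (Orb Λ)) ℂ) (N : ℕ)
    {c μ : ℝ} (hm : H.minEnergyOn (szSector N 0) - H.minEnergyOn (szSector (N - 2) 0) ≤ 2 * μ + c)
    (hp : 2 * μ - c ≤ H.minEnergyOn (szSector (N + 2) 0) - H.minEnergyOn (szSector N 0)) :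
    |2 * μ - 2 * pairChemicalPotential H N| ≤ pairGap H N + c := by
  have ep := minEnergyOn_add_two_sub_eq_pairGap H N
  have em := minEnergyOn_sub_two_sub_eq_pairGap H N
  rw [abs_le]
  constructor <;> linarith

end Algebra

/-! ### §2 The typed position: (Ch) at `(U, δ)` ⟺ the pair-transfer window at `(U, δ)` -/

/-- **(Ch) at a point ⟺ the pair-transfer window at that point.** For every real `U, δ` (no hypothesis:
`neg_le_pairGap_iff_exists_pairTransferWindow` under the quantifiers, with the SAME `κ, L₀`):
`[∃ κ ≥ 0, ∃ L₀, ∀ even L ≥ L₀, −κ/L ≤ pairGap (hubbardTorus 2 L 1 U) N_L]` iff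
`[∃ κ ≥ 0, ∃ L₀, ∀ even L ≥ L₀, ∃ μ, E(N_L) − E(N_L−2) ≤ 2μ + κ/L ∧ 2μ − κ/L ≤ E(N_L+2) − E(N_L)]`,
`N_L = 2⌊(1−δ)L²/2⌋`, `E(M) = (hubbardTorus 2 L 1 U).minEnergyOn (szSector M 0)`. The right-hand side is the
missing estimate named in the wave-3 audit: `μ`-continuity across `N_L` at scale `1/L`. [folklore] -/
theorem chargingFloorAt_iff_pairTransferWindowAt (U δ : ℝ) :
    (∃ κ : ℝ, 0 ≤ κ ∧ ∃ L₀ : ℕ, ∀ (L : ℕ) [NeZero L], L₀ ≤ L → Even L →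
      -(κ / (L : ℝ)) ≤ pairGap (hubbardTorus 2 L 1 U) (2 * ⌊(1 - δ) * (L : ℝ) ^ 2 / 2⌋₊)) ↔
    (∃ κ : ℝ, 0 ≤ κ ∧ ∃ L₀ : ℕ, ∀ (L : ℕ) [NeZero L], L₀ ≤ L → Even L → ∃ μ : ℝ,
      (hubbardTorus 2 L 1 U).minEnergyOn (szSector (2 * ⌊(1 - δ) * (L : ℝ) ^ 2 / 2⌋₊) 0) -
          (hubbardTorus 2 L 1 U).minEnergyOn (szSector (2 * ⌊(1 - δ) * (L : ℝ) ^ 2 / 2⌋₊ - 2) 0) ≤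
        2 * μ + κ / L ∧
      2 * μ - κ / L ≤
        (hubbardTorus 2 L 1 U).minEnergyOn (szSector (2 * ⌊(1 - δ) * (L : ℝ) ^ 2 / 2⌋₊ + 2) 0) -
          (hubbardTorus 2 L 1 U).minEnergyOn (szSector (2 * ⌊(1 - δ) * (L : ℝ) ^ 2 / 2⌋₊) 0)) := by
  constructor
  · rintro ⟨κ, hκ, L₀, h⟩
    exact ⟨κ, hκ, L₀, fun L _ hL hev => ⟨_, pairTransferWindow_of_neg_le_pairGap _ _ (h L hL hev)⟩⟩
  · rintro ⟨κ, hκ, L₀, h⟩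
    refine ⟨κ, hκ, L₀, fun L _ hL hev => ?_⟩
    obtain ⟨μ, hm, hp⟩ := h L hL hev
    exact neg_le_pairGap_of_pairTransferWindow _ _ hm hp

/-- Registered one-line sub-goal form of `chargingFloorAt_iff_pairTransferWindowAt` (item
stmt-HubbardSuperconductivity-7331, line `redirect_birth`, stub (GS-box), lead c11 wave 4): at every `(U, δ)`,
(Ch)-body ↔ pair-transfer-window body. [folklore] -/
theorem chargingFloorAtIffPairTransferWindowAt : ∀ U δ : ℝ, (∃ κ : ℝ, 0 ≤ κ ∧ ∃ L₀ : ℕ, ∀ (L : ℕ) [NeZero L], L₀ ≤ L → Even L → -(κ / (L : ℝ)) ≤ pairGap (hubbardTorus 2 L 1 U) (2 * ⌊(1 - δ) * (L : ℝ) ^ 2 / 2⌋₊)) ↔ (∃ κ : ℝ, 0 ≤ κ ∧ ∃ L₀ : ℕ, ∀ (L : ℕ) [NeZero L], L₀ ≤ L → Even L → ∃ μ : ℝ, (hubbardTorus 2 L 1 U).minEnergyOn (szSector (2 * ⌊(1 - δ) * (L : ℝ) ^ 2 / 2⌋₊) 0) - (hubbardTorus 2 L 1 U).minEnergyOn (szSector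 (2 * ⌊(1 - δ) * (L : ℝ) ^ 2 / 2⌋₊ - 2) 0) ≤ 2 * μ + κ / L ∧ 2 * μ - κ / L ≤ (hubbardTorus 2 L 1 U).minEnergyOn (szSector (2 * ⌊(1 - δ) * (L : ℝ) ^ 2 / 2⌋₊ + 2) 0) - (hubbardTorus 2 L 1 U).minEnergyOn (szSector (2 * ⌊(1 - δ) * (L : ℝ) ^ 2 / 2⌋₊) 0)) :=
  chargingFloorAt_iff_pairTransferWindowAt

/-- **Box form.** (Ch) at every point of the box `U ∈ (0,6]`, `δ ∈ [1/10,3/10]` iff the pair-transfer window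
at every point of the box (pointwise `chargingFloorAt_iff_pairTransferWindowAt`). [folklore] -/
theorem boxChargingFloor_iff_boxPairTransferWindow :
    (∀ U : ℝ, U ∈ Set.Ioc (0:ℝ) 6 → ∀ δ : ℝ, δ ∈ Set.Icc (1 / 10 : ℝ) (3 / 10) →
      ∃ κ : ℝ, 0 ≤ κ ∧ ∃ L₀ : ℕ, ∀ (L : ℕ) [NeZero L], L₀ ≤ L → Even L →
        -(κ / (L : ℝ)) ≤ pairGap (hubbardTorus 2 L 1 U) (2 * ⌊(1 - δ) * (L : ℝ) ^ 2 / 2⌋₊)) ↔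
    (∀ U : ℝ, U ∈ Set.Ioc (0:ℝ) 6 → ∀ δ : ℝ, δ ∈ Set.Icc (1 / 10 : ℝ) (3 / 10) →
      ∃ κ : ℝ, 0 ≤ κ ∧ ∃ L₀ : ℕ, ∀ (L : ℕ) [NeZero L], L₀ ≤ L → Even L → ∃ μ : ℝ,
        (hubbardTorus 2 L 1 U).minEnergyOn (szSector (2 * ⌊(1 - δ) * (L : ℝ) ^ 2 / 2⌋₊) 0) -
            (hubbardTorus 2 L 1 U).minEnergyOn (szSector (2 * ⌊(1 - δ) * (L : ℝ) ^ 2 / 2⌋₊ - 2) 0) ≤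
          2 * μ + κ / L ∧
        2 * μ - κ / L ≤
          (hubbardTorus 2 L 1 U).minEnergyOn (szSector (2 * ⌊(1 - δ) * (L : ℝ) ^ 2 / 2⌋₊ + 2) 0) -
            (hubbardTorus 2 L 1 U).minEnergyOn (szSector (2 * ⌊(1 - δ) * (L : ℝ) ^ 2 / 2⌋₊) 0)) :=
  forall₂_congr fun U _ => forall₂_congr fun δ _ => chargingFloorAt_iff_pairTransferWindowAt U δ

/-- **The new position feeds the stub.** Box-restricted (GD) = C⁺_λ (the body of
`WindowInfraredBound.stub_pairGaussianDomination` at each box point) and the box-restricted PAIR-TRANSFER WINDOW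
imply the registered stub (GS-box) `stub_pairGoldstoneShapeOnBox` verbatim: translate the window into (Ch)
(`boxChargingFloor_iff_boxPairTransferWindow`) and apply wave 3's
`stub_pairGoldstoneShapeOnBox_of_boxPgd_of_boxChargingFloor`. [folklore] -/
theorem stub_pairGoldstoneShapeOnBox_of_boxPgd_of_boxPairTransferWindow
    (hGD : ∀ U : ℝ, U ∈ Set.Ioc (0:ℝ) 6 → ∀ δ : ℝ, δ ∈ Set.Icc (1 / 10 : ℝ) (3 / 10) →
      ∃ C_χ c₀ η : ℝ, 0 ≤ C_χ ∧ 0 ≤ c₀ ∧ 0 < η ∧ ∃ L₀ : ℕ,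
      ∀ (L : ℕ) [NeZero L], L₀ ≤ L → Even L → ∀ m : TorusSite 2 L, m ≠ 0 → momentumNormSq L m ≤ η ^ 2 →
        ∀ t : ℝ,
          ((hubbardTorus 2 L 1 U).minEnergyOn (szSector (2 * ⌊(1 - δ) * (L : ℝ) ^ 2 / 2⌋₊) 0) -
              ((hubbardTorus 2 L 1 U).minEnergyOn (szSector (2 * ⌊(1 - δ) * (L : ℝ) ^ 2 / 2⌋₊) 0) -
                  (hubbardTorus 2 L 1 U).minEnergyOn (szSector (2 * ⌊(1 - δ) * (L : ℝ) ^ 2 / 2⌋₊ - 2) 0) +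
                  c₀ * momentumNormSq L m) / 2 * ((2 * ⌊(1 - δ) * (L : ℝ) ^ 2 / 2⌋₊ : ℕ) : ℝ) -
              C_χ * (L : ℝ) ^ 2 / momentumNormSq L m * t ^ 2 ≤
            (hubbardTorus 2 L 1 U -
              ((((hubbardTorus 2 L 1 U).minEnergyOn (szSector (2 * ⌊(1 - δ) * (L : ℝ) ^ 2 / 2⌋₊) 0) -
                  (hubbardTorus 2 L 1 U).minEnergyOn (szSector (2 * ⌊(1 - δ) * (L : ℝ) ^ 2 / 2⌋₊ - 2) 0) +
                  c₀ * momentumNormSq L m) / 2 : ℝ) : ℂ) •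
                (totalNumber : Matrix (Finset (Orb (FermionTorus 2 L))) (Finset (Orb (FermionTorus 2 L))) ℂ) -
              (t : ℂ) • (pairFieldAt dWaveFormFactor L m + (pairFieldAt dWaveFormFactor L m)ᴴ)).minEnergyOn
              (szSector (2 * ⌊(1 - δ) * (L : ℝ) ^ 2 / 2⌋₊ - 2) 0 ⊔
                szSector (2 * ⌊(1 - δ) * (L : ℝ) ^ 2 / 2⌋₊) 0)) ∧
          ((hubbardTorus 2 L 1 U).minEnergyOn (szSector (2 * ⌊(1 - δ) * (L : ℝ) ^ 2 / 2⌋₊) 0) -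
              ((hubbardTorus 2 L 1 U).minEnergyOn (szSector (2 * ⌊(1 - δ) * (L : ℝ) ^ 2 / 2⌋₊ + 2) 0) -
                  (hubbardTorus 2 L 1 U).minEnergyOn (szSector (2 * ⌊(1 - δ) * (L : ℝ) ^ 2 / 2⌋₊) 0) -
                  c₀ * momentumNormSq L m) / 2 * ((2 * ⌊(1 - δ) * (L : ℝ) ^ 2 / 2⌋₊ : ℕ) : ℝ) -
              C_χ * (L : ℝ) ^ 2 / momentumNormSq L m * t ^ 2 ≤
            (hubbardTorus 2 L 1 U -
              ((((hubbardTorus 2 L 1 U).minEnergyOn (szSector (2 * ⌊(1 - δ) * (L : ℝ) ^ 2 / 2⌋₊ + 2) 0) -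
                  (hubbardTorus 2 L 1 U).minEnergyOn (szSector (2 * ⌊(1 - δ) * (L : ℝ) ^ 2 / 2⌋₊) 0) -
                  c₀ * momentumNormSq L m) / 2 : ℝ) : ℂ) •
                (totalNumber : Matrix (Finset (Orb (FermionTorus 2 L))) (Finset (Orb (FermionTorus 2 L))) ℂ) -
              (t : ℂ) • (pairFieldAt dWaveFormFactor L m + (pairFieldAt dWaveFormFactor L m)ᴴ)).minEnergyOn
              (szSector (2 * ⌊(1 - δ) * (L : ℝ) ^ 2 / 2⌋₊) 0 ⊔
                szSector (2 * ⌊(1 - δ) * (L : ℝ) ^ 2 / 2⌋₊ + 2) 0)))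
    (hW : ∀ U : ℝ, U ∈ Set.Ioc (0:ℝ) 6 → ∀ δ : ℝ, δ ∈ Set.Icc (1 / 10 : ℝ) (3 / 10) →
      ∃ κ : ℝ, 0 ≤ κ ∧ ∃ L₀ : ℕ, ∀ (L : ℕ) [NeZero L], L₀ ≤ L → Even L → ∃ μ : ℝ,
        (hubbardTorus 2 L 1 U).minEnergyOn (szSector (2 * ⌊(1 - δ) * (L : ℝ) ^ 2 / 2⌋₊) 0) -
            (hubbardTorus 2 L 1 U).minEnergyOn (szSector (2 * ⌊(1 - δ) * (L : ℝ) ^ 2 / 2⌋₊ - 2) 0) ≤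
          2 * μ + κ / L ∧
        2 * μ - κ / L ≤
          (hubbardTorus 2 L 1 U).minEnergyOn (szSector (2 * ⌊(1 - δ) * (L : ℝ) ^ 2 / 2⌋₊ + 2) 0) -
            (hubbardTorus 2 L 1 U).minEnergyOn (szSector (2 * ⌊(1 - δ) * (L : ℝ) ^ 2 / 2⌋₊) 0)) :
    ∀ U : ℝ, U ∈ Set.Ioc (0:ℝ) 6 → ∀ δ : ℝ, δ ∈ Set.Icc (1 / 10 : ℝ) (3 / 10) →
      ∃ A ε₀ : ℝ, 0 ≤ A ∧ 0 < ε₀ ∧ ∃ L₀ : ℕ,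
      ∀ (L : ℕ) [NeZero L], L₀ ≤ L → Even L →
        ∀ ψ : Fock (Orb (FermionTorus 2 L)), star ψ ⬝ᵥ ψ = 1 →
          IsGroundStateInSector (hubbardTorus 2 L 1 U) (2 * ⌊(1 - δ) * (L : ℝ) ^ 2 / 2⌋₊) 0 ψ →
            ∀ m : TorusSite 2 L, m ≠ 0 → momentumNormSq L m ≤ ε₀ ^ 2 →
              pairStructureFactor dWaveFormFactor L ψ m * Real.sqrt (momentumNormSq L m) ≤ A :=
  stub_pairGoldstoneShapeOnBox_of_boxPgd_of_boxChargingFloor hGD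
    (boxChargingFloor_iff_boxPairTransferWindow.2 hW)

/-! ### §3 What the tree proves today: the a-priori `O(1)` two-sided window -/

section Window

variable {L : ℕ} [NeZero L]

/-- **The one-step window at an even filling** (repulsive torus of even side, `2n + 2 ≤ L²`):
`−8 ≤ E(2n+2) − E(2n) ≤ U`. Upper: Yang's `η†` transfer (`EnslavedA1g.minEnergyOn_szSector_add_two_le`);
lower: two one-electron removals at cost `≤ 4` each (`EnslavedA1g.UpperSandwich.minEnergyOn_szSector_le_add_two`).
These are the two one-sided variational halves of (Ch), with MISMATCHED chemical potentials `2μ₊ = U`,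
`2μ₋ = −8`. [folklore] -/
theorem pairStep_mem_window (hev : Even L) {U : ℝ} (hU : 0 ≤ U) {n : ℕ} (hn : 2 * n + 2 ≤ L ^ 2) :
    -8 ≤ (hubbardTorus 2 L 1 U).minEnergyOn (szSector (2 * n + 2) 0) -
        (hubbardTorus 2 L 1 U).minEnergyOn (szSector (2 * n) 0) ∧
      (hubbardTorus 2 L 1 U).minEnergyOn (szSector (2 * n + 2) 0) -
        (hubbardTorus 2 L 1 U).minEnergyOn (szSector (2 * n) 0) ≤ U := by
  have hη := Summit.HubbardSuperconductivity.EnslavedA1g.minEnergyOn_szSector_add_two_le hev U (m := n) hn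
  have hrem :=
    Summit.HubbardSuperconductivity.HubbardSuperconductivity.Theorems.EnslavedA1g.UpperSandwich.minEnergyOn_szSector_le_add_two
      L 1 hU (n := n) (by omega)
  rw [show 2 * (n + 1) = 2 * n + 2 by ring] at hη; rw [abs_one, mul_one] at hrem
  constructor <;> linarith

/-- **The sharpest a-priori two-sided window on the pair gap** (repulsive torus of even side, `1 ≤ n`,
`2n + 2 ≤ L²`): `|pairGap (hubbardTorus 2 L 1 U) (2n)| ≤ (U + 8)/2` — difference of the one-step windows `[−8, U]`
at `2n − 2` and `2n` (lower half = `J = 1` in `WcbcsSsbToTorusLRO.exists_pairGap_ge_of_window`). [folklore] -/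
theorem abs_pairGap_le_of_window (hev : Even L) {U : ℝ} (hU : 0 ≤ U) {n : ℕ} (hn1 : 1 ≤ n)
    (hn : 2 * n + 2 ≤ L ^ 2) :
    |pairGap (hubbardTorus 2 L 1 U) (2 * n)| ≤ (U + 8) / 2 := by
  obtain ⟨k, rfl⟩ : ∃ k, n = k + 1 := ⟨n - 1, by omega⟩
  have hp := pairStep_mem_window hev hU (n := k + 1) hn
  have hm := pairStep_mem_window hev hU (n := k) (by omega)
  rw [show 2 * k + 2 = 2 * (k + 1) by ring] at hm
  unfold pairGap
  rw [show 2 * (k + 1) - 2 = 2 * k by omega, abs_le]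
  constructor <;> linarith

/-- **The prescribed filling is admissible**: `N_L + 2 ≤ L²` for `δ > 0` and even `L ≥ 1`
(`N_L = 2⌊(1−δ)L²/2⌋ ≤ (1−δ)L² < L²`, and both sides are even). [folklore] -/
theorem summitFilling_add_two_le_sq {δ : ℝ} (hδ : 0 < δ) (hev : Even L) :
    2 * ⌊(1 - δ) * (L : ℝ) ^ 2 / 2⌋₊ + 2 ≤ L ^ 2 := by
  obtain ⟨k, hk⟩ := hev
  have hk0 : 0 < k := by have := NeZero.pos L; omega
  have hkr : (0 : ℝ) < k := by exact_mod_cast hk0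
  have hlt : ⌊(1 - δ) * (L : ℝ) ^ 2 / 2⌋₊ < 2 * k ^ 2 := by
    rw [Nat.floor_lt' (by positivity), hk]
    push_cast
    nlinarith [mul_pos hδ (mul_pos hkr hkr)]
  calc 2 * ⌊(1 - δ) * (L : ℝ) ^ 2 / 2⌋₊ + 2 = 2 * (⌊(1 - δ) * (L : ℝ) ^ 2 / 2⌋₊ + 1) := by ring
    _ ≤ 2 * (2 * k ^ 2) := Nat.mul_le_mul_left 2 hlt
    _ = L ^ 2 := by rw [hk]; ring

/-- **The two one-sided halves at the prescribed filling.** For `U ≥ 0`, `δ ∈ (0,1/2)`, even `L ≥ 2`,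
`N = N_L`: both pair steps through `N_L` lie in `[−8, U]` — `−8 ≤ E(N) − E(N−2) ≤ U`, `−8 ≤ E(N+2) − E(N) ≤ U`
(η-ceiling + removal floor). The tree's transfer maps `η†` (cost exactly `U`) and two one-electron removals (cost
`≥ −8`) MISMATCH by `U + 8 = Θ(1)`; (Ch) needs a common `μ` up to `κ/L`. [folklore] -/
theorem summitFilling_steps_mem_window {U δ : ℝ} (hU : 0 ≤ U) (hδ : δ ∈ Set.Ioo (0:ℝ) (1 / 2))
    (hL : 2 ≤ L) (hev : Even L) :
    (-8 ≤ (hubbardTorus 2 L 1 U).minEnergyOn (szSector (2 * ⌊(1 - δ) * (L : ℝ) ^ 2 / 2⌋₊) 0) -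
          (hubbardTorus 2 L 1 U).minEnergyOn (szSector (2 * ⌊(1 - δ) * (L : ℝ) ^ 2 / 2⌋₊ - 2) 0) ∧
      (hubbardTorus 2 L 1 U).minEnergyOn (szSector (2 * ⌊(1 - δ) * (L : ℝ) ^ 2 / 2⌋₊) 0) -
          (hubbardTorus 2 L 1 U).minEnergyOn (szSector (2 * ⌊(1 - δ) * (L : ℝ) ^ 2 / 2⌋₊ - 2) 0) ≤ U) ∧
    (-8 ≤ (hubbardTorus 2 L 1 U).minEnergyOn (szSector (2 * ⌊(1 - δ) * (L : ℝ) ^ 2 / 2⌋₊ + 2) 0) -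
          (hubbardTorus 2 L 1 U).minEnergyOn (szSector (2 * ⌊(1 - δ) * (L : ℝ) ^ 2 / 2⌋₊) 0) ∧
      (hubbardTorus 2 L 1 U).minEnergyOn (szSector (2 * ⌊(1 - δ) * (L : ℝ) ^ 2 / 2⌋₊ + 2) 0) -
          (hubbardTorus 2 L 1 U).minEnergyOn (szSector (2 * ⌊(1 - δ) * (L : ℝ) ^ 2 / 2⌋₊) 0) ≤ U) := by
  have h2 : 2 ≤ 2 * ⌊(1 - δ) * (L : ℝ) ^ 2 / 2⌋₊ := wib_two_le_summitFilling hδ hL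
  have htop := summitFilling_add_two_le_sq hδ.1 hev
  set n : ℕ := ⌊(1 - δ) * (L : ℝ) ^ 2 / 2⌋₊ with hn
  obtain ⟨k, hk⟩ : ∃ k, n = k + 1 := ⟨n - 1, by omega⟩
  refine ⟨?_, pairStep_mem_window hev hU (n := n) htop⟩
  have h := pairStep_mem_window hev hU (n := k) (by omega)
  rwa [show 2 * k + 2 = 2 * n by omega, show 2 * k = 2 * n - 2 by omega] at h

/-- **The a-priori window at the prescribed filling.** For `U ≥ 0`, `δ ∈ (0,1/2)` and EVERY even `L ≥ 2`:
`|pairGap (hubbardTorus 2 L 1 U) N_L| ≤ (U + 8)/2`. (Ch) at `(U, δ)` asks to improve the LOWER half of this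
`O(1)` window to `−κ/L`; nothing sharper is proved in the tree at any box point. [folklore] -/
theorem abs_pairGap_summitFilling_le {U δ : ℝ} (hU : 0 ≤ U) (hδ : δ ∈ Set.Ioo (0:ℝ) (1 / 2))
    (hL : 2 ≤ L) (hev : Even L) :
    |pairGap (hubbardTorus 2 L 1 U) (2 * ⌊(1 - δ) * (L : ℝ) ^ 2 / 2⌋₊)| ≤ (U + 8) / 2 :=
  abs_pairGap_le_of_window hev hU (by have := wib_two_le_summitFilling hδ hL; omega)
    (summitFilling_add_two_le_sq hδ.1 hev)

/-- **The a-priori window in the pair-transfer language.** For `U ≥ 0`, `δ ∈ (0,1/2)` and every even `L ≥ 2`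
the pair-transfer window at `N_L` holds with the `O(1)` slack `(U + 8)/2` in place of `κ/L` (common `μ = μ̄_L`);
(Ch) ⟺ the same with slack `κ/L` (`chargingFloorAt_iff_pairTransferWindowAt`). [folklore] -/
theorem pairTransferWindowAt_apriori {U δ : ℝ} (hU : 0 ≤ U) (hδ : δ ∈ Set.Ioo (0:ℝ) (1 / 2))
    (hL : 2 ≤ L) (hev : Even L) :
    ∃ μ : ℝ,
      (hubbardTorus 2 L 1 U).minEnergyOn (szSector (2 * ⌊(1 - δ) * (L : ℝ) ^ 2 / 2⌋₊) 0) -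
          (hubbardTorus 2 L 1 U).minEnergyOn (szSector (2 * ⌊(1 - δ) * (L : ℝ) ^ 2 / 2⌋₊ - 2) 0) ≤
        2 * μ + (U + 8) / 2 ∧
      2 * μ - (U + 8) / 2 ≤
        (hubbardTorus 2 L 1 U).minEnergyOn (szSector (2 * ⌊(1 - δ) * (L : ℝ) ^ 2 / 2⌋₊ + 2) 0) -
          (hubbardTorus 2 L 1 U).minEnergyOn (szSector (2 * ⌊(1 - δ) * (L : ℝ) ^ 2 / 2⌋₊) 0) :=
  (neg_le_pairGap_iff_exists_pairTransferWindow _ _ _).1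
    (abs_le.1 (abs_pairGap_summitFilling_le hU hδ hL hev)).1

end Window

/-- **On the box: `|pairGap| ≤ 7` at the prescribed filling, for every even `L ≥ 2`.** At every
`U ∈ (0,6]`, `δ ∈ [1/10,3/10]`: `−7 ≤ pairGap (hubbardTorus 2 L 1 U) N_L ≤ 7` (`(U + 8)/2 ≤ 7`). This is the
complete variational information the tree has on the (Ch) quantity inside the box. [folklore] -/
theorem abs_pairGap_summitFilling_le_seven_onBox :
    ∀ U : ℝ, U ∈ Set.Ioc (0:ℝ) 6 → ∀ δ : ℝ, δ ∈ Set.Icc (1 / 10 : ℝ) (3 / 10) →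
      ∀ (L : ℕ) [NeZero L], 2 ≤ L → Even L →
        |pairGap (hubbardTorus 2 L 1 U) (2 * ⌊(1 - δ) * (L : ℝ) ^ 2 / 2⌋₊)| ≤ 7 := by
  intro U hU δ hδ L _ hL hev
  have hδ' : δ ∈ Set.Ioo (0:ℝ) (1 / 2) := ⟨by linarith [hδ.1], by linarith [hδ.2]⟩
  have h := abs_pairGap_summitFilling_le hU.1.le hδ' hL hev
  linarith [hU.2]

/-! ### §4 The edge of the box: (Ch) holds at half filling, `κ = 0` -/

section HalfFilling

variable {L : ℕ} [NeZero L]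

/-- **The pair gap at half filling** (even side `L`, any real `U`):
`pairGap (hubbardTorus 2 L 1 U) (L²) = U − (E(L²) − E(L²−2))`, `E(M) = minEnergyOn … (szSector M 0)`:
the three `S^z = 0` sector energies are full `N`-particle ground energies (Lieb 1989,
`groundEnergyAt_eq_minEnergyOn_szSector`) and particle–hole symmetry gives `E(L²+2) = E(L²−2) + 2U`
(`ParentFirstSMA.groundEnergyAt_fermionTorus2_halfFilling_add`, Lieb–Wu 2003 eq. (3)). [folklore] -/
theorem pairGap_halfFilling_eq (hev : Even L) (U : ℝ) :
    pairGap (hubbardTorus 2 L 1 U) (L ^ 2) =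
      U - ((hubbardTorus 2 L 1 U).minEnergyOn (szSector (L ^ 2) 0) -
        (hubbardTorus 2 L 1 U).minEnergyOn (szSector (L ^ 2 - 2) 0)) := by
  obtain ⟨k, hk⟩ := hev
  have hsq : L ^ 2 = 2 * (2 * k ^ 2) := by rw [hk]; ring
  have hk1 : 1 ≤ k ^ 2 := Nat.one_le_pow _ _ (by have := NeZero.pos L; omega)
  have hc : Fintype.card (FermionTorus 2 L) = L ^ 2 := card_fermionTorus 2 L
  have e0 : (hubbardTorus 2 L 1 U).minEnergyOn (szSector (L ^ 2) 0) =
      groundEnergyAt (fermionTorusGraph 2 L) 1 U (L ^ 2) := by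
    rw [hsq]
    exact (groundEnergyAt_eq_minEnergyOn_szSector (fermionTorusGraph 2 L) 1 U (by rw [hc]; omega)).symm
  have em : (hubbardTorus 2 L 1 U).minEnergyOn (szSector (L ^ 2 - 2) 0) =
      groundEnergyAt (fermionTorusGraph 2 L) 1 U (L ^ 2 - 2) := by
    rw [show L ^ 2 - 2 = 2 * (2 * k ^ 2 - 1) by omega]
    exact (groundEnergyAt_eq_minEnergyOn_szSector (fermionTorusGraph 2 L) 1 U (by rw [hc]; omega)).symm
  have ep : (hubbardTorus 2 L 1 U).minEnergyOn (szSector (L ^ 2 + 2) 0) =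
      groundEnergyAt (fermionTorusGraph 2 L) 1 U (L ^ 2 + 2) := by
    rw [show L ^ 2 + 2 = 2 * (2 * k ^ 2 + 1) by omega]
    exact (groundEnergyAt_eq_minEnergyOn_szSector (fermionTorusGraph 2 L) 1 U (by rw [hc]; omega)).symm
  have hph := ParentFirstSMA.groundEnergyAt_fermionTorus2_halfFilling_add ⟨k, hk⟩ U (j := 2) (by omega)
  unfold pairGap
  rw [ep, em, e0, hph]; push_cast; ring

/-- **(Ch) at half filling, pointwise in `L`, `κ = 0`**: `0 ≤ pairGap (hubbardTorus 2 L 1 U) (L²)` for even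
`L` and every real `U` — `pairGap_halfFilling_eq` and Yang's ceiling `E(L²) ≤ E(L²−2) + U`. Pair convexity at
the particle–hole symmetric point; says nothing at `δ > 0`. [folklore] -/
theorem pairGap_halfFilling_nonneg (hev : Even L) (U : ℝ) : 0 ≤ pairGap (hubbardTorus 2 L 1 U) (L ^ 2) := by
  obtain ⟨k, hk⟩ := hev
  have hsq : L ^ 2 = 2 * (2 * k ^ 2) := by rw [hk]; ring
  have hk1 : 1 ≤ k ^ 2 := Nat.one_le_pow _ _ (by have := NeZero.pos L; omega)
  have hη := Summit.HubbardSuperconductivity.EnslavedA1g.minEnergyOn_szSector_add_two_le ⟨k, hk⟩ U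
    (m := 2 * k ^ 2 - 1) (by omega)
  rw [show 2 * (2 * k ^ 2 - 1 + 1) = L ^ 2 by omega, show 2 * (2 * k ^ 2 - 1) = L ^ 2 - 2 by omega] at hη
  rw [pairGap_halfFilling_eq ⟨k, hk⟩ U]
  linarith

omit [NeZero L] in
/-- `N_L = L²` at `δ = 0` for even `L`. [folklore] -/
theorem summitFilling_zero_eq_sq (hev : Even L) : 2 * ⌊(1 - (0 : ℝ)) * (L : ℝ) ^ 2 / 2⌋₊ = L ^ 2 := by
  obtain ⟨k, hk⟩ := hev
  have h : (1 - (0 : ℝ)) * (L : ℝ) ^ 2 / 2 = ((2 * k ^ 2 : ℕ) : ℝ) := by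
    rw [hk]; push_cast; ring
  rw [h, Nat.floor_natCast, hk]; ring

end HalfFilling

/-- **(Ch) HOLDS at the edge `δ = 0` of the box, with `κ = 0`, for every real `U`** — the (Ch)-body of
`chargingFloorAt_iff_pairTransferWindowAt` at `δ = 0`, verbatim: `N_L = L²` for even `L` (`summitFilling_zero_eq_sq`)
and `pairGap_halfFilling_nonneg`. Inside the box (`δ ≥ 1/10`) (Ch) is open. [folklore] -/
theorem chargingFloorAt_halfFilling (U : ℝ) :
    ∃ κ : ℝ, 0 ≤ κ ∧ ∃ L₀ : ℕ, ∀ (L : ℕ) [NeZero L], L₀ ≤ L → Even L →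
      -(κ / (L : ℝ)) ≤ pairGap (hubbardTorus 2 L 1 U) (2 * ⌊(1 - (0 : ℝ)) * (L : ℝ) ^ 2 / 2⌋₊) := by
  refine ⟨0, le_rfl, 0, fun L _ _ hev => ?_⟩
  rw [summitFilling_zero_eq_sq hev, zero_div, neg_zero]
  exact pairGap_halfFilling_nonneg hev U

end Summit.HubbardSuperconductivity.HubbardSuperconductivity.Theorems.FunctionFieldCertificate
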